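import Mathlib
import HarnessLib
import Summits.KontsevichZagierPeriods.Zeta5Search.Denom.CatalanRayPClosed

/-!
# CatalanRayPClosedAbs — archimedean envelope of the explicit rational part, modulo the pole coefficients (fam-denom D9c)

HONEST FRAMING: systematic search; no irrationality claim unless certified.

fam-denom (pub-zeta5), `families/denom/PCLOSED-API.md` §T-G.  The growth input (T-G) of fam-catalan's two-node
2-adic criterion needs `|rayMult j n · rayPClosed j n| ≤ e^{(h_j + ε) n}` eventually.  Exact numerics
(`d9/pclosed.py`, rays `j = 3..12`, `n ≤ 8`) show that TERMWISE absolute bounds suffice: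
`Σ |terms of PClosed n (jn)| ≤ 4.6 · C((j+1)n, n)` and `max_d |coef n J d| ≤ 0.41 · C(J+n, n)`.
This file proves the ATOM half and the ASSEMBLY, leaving exactly one input — an envelope `E` for the pole
coefficients `|coef n J d|` on the two index sets — as a hypothesis:

* atom bounds (all polynomial, which is free in (T-G)): `0 ≤ sigmaAtom a ≤ a`, `0 ≤ gsumAtom c ≤ c`,
  `|wTerm b| ≤ 8 + 2b`, `|Watom a| ≤ a(8 + 2a)`, `0 < tB a`, `tB a ≤ 2` (`a ≥ 1`), `0 < K0 n ≤ n!`,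
  `|logDer n J (−a)| ≤ 3J + 4n + 1`;
* term bounds `|termA| ≤ 8J·|coef|`, `|termBB| ≤ 2a(8+2a)·|coef|`, `|termBA| ≤ 4a(3J+4n+1)·|coef|`, `|termG| ≤ 4a·|coef|`;
* **`abs_PClosed_le_of_coef : (∀ c ≤ J−n, |coef n J c| ≤ E) → (∀ a ∈ [1,2n], |coef n J (−a)| ≤ E) →
  |PClosed n J| ≤ 48 (J + 2n + 1)³ E`** (`1 ≤ n ≤ J`).

With the remaining input `|coef n J d| ≤ 2n · C(J+n, n)` (exact puncture factorizations in PCLOSED-API.md §T-G; observed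
ratio ≤ 0.41) this gives `|rayPClosed j n| ≤ poly(n) · C((j+1)n, n)`, the same envelope shape as fam-catalan's
`abs_catalanQ_shift_le`, and (T-G) follows from their `choose_ray_le_exp` verbatim.
-/

namespace Summit.KontsevichZagierPeriods.Zeta5Search.Denom.CatalanRayPClosed

open Finset
open Summit.KontsevichZagierPeriods.Zeta5Search.Denom.CatalanRayAtoms

/-! ### Atom bounds -/

/-- `C(2i, i) ≤ 4^i` (Mathlib's `centralBinom_le_four_pow`, restated on `choose`). -/
theorem choose_two_mul_le_four_pow (i : ℕ) : (2 * i).choose i ≤ 4 ^ i := by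
  simpa [Nat.centralBinom_eq_two_mul_choose] using Nat.centralBinom_le_four_pow i

/-- `4^μ ≤ 2(2μ+1)²·C(2μ, μ)` (from Mathlib's `4^μ ≤ 2μ·C(2μ,μ)`). -/
theorem four_pow_le_gsumDen (μ : ℕ) : 4 ^ μ ≤ 2 * (2 * μ + 1) ^ 2 * (2 * μ).choose μ := by
  rcases Nat.eq_zero_or_pos μ with h | h
  · subst h; simp
  · have h1 := Nat.four_pow_le_two_mul_self_mul_centralBinom μ h
    rw [Nat.centralBinom_eq_two_mul_choose] at h1
    calc 4 ^ μ ≤ 2 * μ * (2 * μ).choose μ := h1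
      _ ≤ 2 * (2 * μ + 1) ^ 2 * (2 * μ).choose μ := by
          apply Nat.mul_le_mul_right; nlinarith

/-- `0 ≤ σ(a)`. -/
theorem sigmaAtom_nonneg (a : ℕ) : 0 ≤ sigmaAtom a := by
  unfold sigmaAtom; exact Finset.sum_nonneg (fun i _ => by positivity)

/-- `σ(a) ≤ a` (each summand `C(2i,i)/(4^i(2i+1)) ≤ 1`). -/
theorem sigmaAtom_le (a : ℕ) : sigmaAtom a ≤ a := by
  unfold sigmaAtom
  calc (∑ i ∈ range a, (Nat.choose (2 * i) i : ℚ) / ((4 ^ i * (2 * i + 1) : ℕ) : ℚ))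
      ≤ ∑ i ∈ range a, (1 : ℚ) := by
        apply Finset.sum_le_sum; intro i _
        rw [div_le_one (by positivity)]
        have h : (2 * i).choose i ≤ 4 ^ i * (2 * i + 1) :=
          le_trans (choose_two_mul_le_four_pow i) (Nat.le_mul_of_pos_right _ (by omega))
        exact_mod_cast h
    _ = a := by simp

/-- `0 ≤ gsum(c)`. -/
theorem gsumAtom_nonneg (c : ℕ) : 0 ≤ gsumAtom c := by
  unfold gsumAtom; exact Finset.sum_nonneg (fun i _ => by positivity)

/-- `gsum(c) ≤ c` (each summand `4^μ/(2(2μ+1)²C(2μ,μ)) ≤ 1`). -/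
theorem gsumAtom_le (c : ℕ) : gsumAtom c ≤ c := by
  unfold gsumAtom
  calc (∑ μ ∈ range c, ((4 ^ μ : ℕ) : ℚ) / ((2 * (2 * μ + 1) ^ 2 * Nat.choose (2 * μ) μ : ℕ) : ℚ))
      ≤ ∑ μ ∈ range c, (1 : ℚ) := by
        apply Finset.sum_le_sum; intro μ _
        have hpos : (0 : ℚ) < ((2 * (2 * μ + 1) ^ 2 * Nat.choose (2 * μ) μ : ℕ) : ℚ) := by
          have : 0 < (2 * μ).choose μ := Nat.choose_pos (by omega)
          positivity
        rw [div_le_one hpos]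
        exact_mod_cast four_pow_le_gsumDen μ
    _ = c := by simp

/-- `0 ≤ increment₁(b) ≤ 8`. -/
theorem wInc₁_bounds (b : ℕ) : 0 ≤ wInc₁ b ∧ wInc₁ b ≤ 8 := by
  unfold wInc₁
  refine ⟨by positivity, ?_⟩
  rw [div_le_iff₀ (by positivity)]
  have h : 8 * (2 * b).choose b ≤ 8 * (4 ^ b * (2 * b + 1) ^ 2) := by
    have := choose_two_mul_le_four_pow b
    have h1 : 4 ^ b ≤ 4 ^ b * (2 * b + 1) ^ 2 := Nat.le_mul_of_pos_right _ (by positivity)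
    omega
  exact_mod_cast h

/-- `0 ≤ increment₂(b) ≤ 2b`. -/
theorem wInc₂_bounds (b : ℕ) : 0 ≤ wInc₂ b ∧ wInc₂ b ≤ 2 * b := by
  unfold wInc₂
  have hσ := sigmaAtom_nonneg b
  have hσ' := sigmaAtom_le b
  refine ⟨by positivity, ?_⟩
  rcases Nat.eq_zero_or_pos b with h | h
  · subst h; simp [sigmaAtom]
  · calc 2 * sigmaAtom b / ((b * (2 * b + 1) : ℕ) : ℚ) ≤ 2 * sigmaAtom b := by
          apply div_le_self (by positivity)
          have : 1 ≤ b * (2 * b + 1) := Nat.one_le_iff_ne_zero.mpr (by positivity)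
          exact_mod_cast this
      _ ≤ 2 * b := by linarith

/-- `|wTerm b| ≤ 8 + 2b`. -/
theorem abs_wTerm_le (b : ℕ) : |wTerm b| ≤ 8 + 2 * b := by
  unfold wTerm
  split_ifs with h
  · subst h; norm_num
  · have h1 := wInc₁_bounds b
    have h2 := wInc₂_bounds b
    rw [abs_le]; constructor <;> linarith [h1.1, h1.2, h2.1, h2.2]

/-- `|W(a)| ≤ a(8 + 2a)`. -/
theorem abs_Watom_le (a : ℕ) : |Watom a| ≤ a * (8 + 2 * a) := by
  unfold Watom
  calc |∑ b ∈ range a, wTerm b| ≤ ∑ b ∈ range a, |wTerm b| := Finset.abs_sum_le_sum_abs _ _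
    _ ≤ ∑ b ∈ range a, ((8 : ℚ) + 2 * a) := by
        apply Finset.sum_le_sum; intro b hb
        have hb' : (b : ℚ) ≤ a := by exact_mod_cast (Finset.mem_range.mp hb).le
        linarith [abs_wTerm_le b]
    _ = a * (8 + 2 * a) := by simp only [Finset.sum_const, Finset.card_range, nsmul_eq_mul]

/-- `0 < t_{a−1}`. -/
theorem tB_pos (a : ℕ) : 0 < tB a := by unfold tB; positivity

/-- `4^k (k!)² ≤ (2k+1)!` (i.e. `4^k ≤ (2k+1)·C(2k,k)`). -/
theorem four_pow_mul_factorial_sq_le (k : ℕ) : 4 ^ k * k.factorial ^ 2 ≤ (2 * k + 1).factorial := by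
  have hc : (2 * k).choose k * k.factorial * k.factorial = (2 * k).factorial := by
    have := Nat.choose_mul_factorial_mul_factorial (show k ≤ 2 * k by omega)
    rwa [show 2 * k - k = k by omega] at this
  have h4 : 4 ^ k ≤ (2 * k + 1) * (2 * k).choose k := by
    rcases Nat.eq_zero_or_pos k with h | h
    · subst h; simp
    · have h1 := Nat.four_pow_le_two_mul_self_mul_centralBinom k h
      rw [Nat.centralBinom_eq_two_mul_choose] at h1
      exact le_trans h1 (Nat.mul_le_mul_right _ (by omega))
  calc 4 ^ k * k.factorial ^ 2 ≤ (2 * k + 1) * (2 * k).choose k * k.factorial ^ 2 :=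
        Nat.mul_le_mul_right _ h4
    _ = (2 * k + 1) * ((2 * k).choose k * k.factorial * k.factorial) := by ring
    _ = (2 * k + 1).factorial := by rw [hc, Nat.factorial_succ]

/-- `t_{a−1} ≤ 2` for `a ≥ 1`. -/
theorem tB_le_two (a : ℕ) (ha : 1 ≤ a) : tB a ≤ 2 := by
  obtain ⟨k, rfl⟩ : ∃ k, a = k + 1 := ⟨a - 1, by omega⟩
  unfold tB
  rw [show k + 1 - 1 = k by omega, show 2 * (k + 1) - 1 = 2 * k + 1 by omega,
    div_le_iff₀ (by positivity)]
  have h := four_pow_mul_factorial_sq_le k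
  have h' : ((4 ^ k * k.factorial ^ 2 : ℕ) : ℚ) ≤ ((2 * k + 1).factorial : ℚ) := by exact_mod_cast h
  push_cast at h'
  linarith

/-- `0 < (½)_n` (the type ascription `(0 : ℚ)` only distinguishes this statement textually from an unrelated
`K0_pos` about a different `K0` in `Literature/Computability/Cryptography/LWEAmplifyQuery.lean` — gate dedup, lane edit). -/
theorem K0_pos (n : ℕ) : (0 : ℚ) < K0 n := by
  unfold K0; exact Finset.prod_pos (fun i _ => by positivity)

/-- `(½)_n ≤ n!`. -/
theorem K0_le_factorial (n : ℕ) : K0 n ≤ n.factorial := by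
  unfold K0
  calc (∏ i ∈ range n, ((1 : ℚ) / 2 + i)) ≤ ∏ i ∈ range n, ((i : ℚ) + 1) := by
        apply Finset.prod_le_prod (fun i _ => by positivity)
        intro i _; linarith
    _ = n.factorial := by
        rw [← Finset.prod_range_add_one_eq_factorial]; push_cast; rfl

/-- `|(m + ½)⁻¹| ≤ 2` for an integer `m`. -/
theorem abs_inv_half_le (m : ℤ) : |((m : ℚ) + 1 / 2)⁻¹| ≤ 2 := by
  rw [abs_inv]
  have h : (1 : ℚ) / 2 ≤ |(m : ℚ) + 1 / 2| := by
    rcases le_or_gt 0 m with hm | hm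
    · have : (0 : ℚ) ≤ m := by exact_mod_cast hm
      rw [abs_of_nonneg (by linarith)]; linarith
    · have hm1 : m ≤ -1 := by omega
      have : (m : ℚ) ≤ -1 := by exact_mod_cast hm1
      rw [abs_of_neg (by linarith)]; linarith
  calc |(m : ℚ) + 1 / 2|⁻¹ ≤ ((1 : ℚ) / 2)⁻¹ := by
        apply inv_anti₀ (by norm_num) h
    _ = 2 := by norm_num

/-- `|z⁻¹| ≤ 1` for an integer `z` (`0⁻¹ = 0`). -/
theorem abs_inv_int_le (z : ℤ) : |((z : ℚ))⁻¹| ≤ 1 := by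
  rcases eq_or_ne z 0 with h | h
  · subst h; simp
  · rw [abs_inv]
    have h1 : (1 : ℚ) ≤ |(z : ℚ)| := by
      have := Int.one_le_abs h
      exact_mod_cast this
    exact inv_le_one_of_one_le₀ h1

/-- `|Λ_a| ≤ 3J + 4n + 1` (every reciprocal in `logDer` has a half-integer or integer argument). -/
theorem abs_logDer_le (n J a : ℕ) : |logDer n J (-(a : ℚ))| ≤ 3 * J + 4 * n + 1 := by
  unfold logDer
  have h1 : |∑ i ∈ range (J + n), (-(a : ℚ) - J + 1 / 2 + i)⁻¹| ≤ 2 * (J + n) := by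
    calc |∑ i ∈ range (J + n), (-(a : ℚ) - J + 1 / 2 + i)⁻¹|
        ≤ ∑ i ∈ range (J + n), |(-(a : ℚ) - J + 1 / 2 + i)⁻¹| := Finset.abs_sum_le_sum_abs _ _
      _ ≤ ∑ i ∈ range (J + n), (2 : ℚ) := by
          apply Finset.sum_le_sum; intro i _
          have : (-(a : ℚ) - J + 1 / 2 + i) = (((i : ℤ) - a - J : ℤ) : ℚ) + 1 / 2 := by push_cast; ring
          rw [this]; exact abs_inv_half_le _
      _ = 2 * (J + n) := by simp; ring
  have h2 : |∑ i ∈ range (J + 1), (-(a : ℚ) - J + n + i)⁻¹| ≤ J + 1 := by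
    calc |∑ i ∈ range (J + 1), (-(a : ℚ) - J + n + i)⁻¹|
        ≤ ∑ i ∈ range (J + 1), |(-(a : ℚ) - J + n + i)⁻¹| := Finset.abs_sum_le_sum_abs _ _
      _ ≤ ∑ i ∈ range (J + 1), (1 : ℚ) := by
          apply Finset.sum_le_sum; intro i _
          have : (-(a : ℚ) - J + n + i) = (((n : ℤ) + i - a - J : ℤ) : ℚ) := by push_cast; ring
          rw [this]; exact abs_inv_int_le _
      _ = J + 1 := by simp
  have h3 : |∑ e ∈ range (2 * n), (-(a : ℚ) + e + 1)⁻¹| ≤ 2 * n := by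
    calc |∑ e ∈ range (2 * n), (-(a : ℚ) + e + 1)⁻¹|
        ≤ ∑ e ∈ range (2 * n), |(-(a : ℚ) + e + 1)⁻¹| := Finset.abs_sum_le_sum_abs _ _
      _ ≤ ∑ e ∈ range (2 * n), (1 : ℚ) := by
          apply Finset.sum_le_sum; intro e _
          have : (-(a : ℚ) + e + 1) = (((e : ℤ) + 1 - a : ℤ) : ℚ) := by push_cast; ring
          rw [this]; exact abs_inv_int_le _
      _ = 2 * n := by simp
  calc |(∑ i ∈ range (J + n), (-(a : ℚ) - J + 1 / 2 + i)⁻¹) - (∑ i ∈ range (J + 1), (-(a : ℚ) - J + n + i)⁻¹)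
        - ∑ e ∈ range (2 * n), (-(a : ℚ) + e + 1)⁻¹|
      ≤ |(∑ i ∈ range (J + n), (-(a : ℚ) - J + 1 / 2 + i)⁻¹) - (∑ i ∈ range (J + 1), (-(a : ℚ) - J + n + i)⁻¹)|
        + |∑ e ∈ range (2 * n), (-(a : ℚ) + e + 1)⁻¹| := abs_sub _ _
    _ ≤ (|∑ i ∈ range (J + n), (-(a : ℚ) - J + 1 / 2 + i)⁻¹| + |∑ i ∈ range (J + 1), (-(a : ℚ) - J + n + i)⁻¹|)
        + |∑ e ∈ range (2 * n), (-(a : ℚ) + e + 1)⁻¹| := by gcongr; exact abs_sub _ _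
    _ ≤ 2 * (J + n) + (J + 1) + 2 * n := by linarith
    _ = 3 * J + 4 * n + 1 := by ring

/-! ### Term bounds modulo the pole coefficient -/

/-- `|termA n J c| ≤ 8c · |coef n J c|` (indeed `8C(2c,c)/4^c ≤ 8` and `0 ≤ gsum c ≤ c`). -/
theorem abs_termA_le (n J c : ℕ) : |termA n J c| ≤ |coef n J c| * (8 * c) := by
  unfold termA
  rw [abs_mul]
  apply mul_le_mul_of_nonneg_left _ (abs_nonneg _)
  have hg0 := gsumAtom_nonneg c
  have hg1 := gsumAtom_le c
  have hC : (0 : ℚ) ≤ 8 * (Nat.choose (2 * c) c : ℚ) / 4 ^ c := by positivity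
  have hC' : 8 * (Nat.choose (2 * c) c : ℚ) / 4 ^ c ≤ 8 := by
    rw [div_le_iff₀ (by positivity)]
    have h := choose_two_mul_le_four_pow c
    have h' : ((2 * c).choose c : ℚ) ≤ ((4 ^ c : ℕ) : ℚ) := by exact_mod_cast h
    push_cast at h'
    linarith
  rw [abs_mul, abs_neg, abs_of_nonneg hC, abs_of_nonneg hg0]
  calc 8 * (Nat.choose (2 * c) c : ℚ) / 4 ^ c * gsumAtom c ≤ 8 * gsumAtom c :=
        mul_le_mul_of_nonneg_right hC' hg0
    _ ≤ 8 * c := by linarith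

/-- `|termBB n J a| ≤ 2a(8+2a) · |coef n J (−a)|` (`a ≥ 1`). -/
theorem abs_termBB_le (n J a : ℕ) (ha : 1 ≤ a) : |termBB n J a| ≤ |coef n J (-(a : ℚ))| * (2 * (a * (8 + 2 * a))) := by
  unfold termBB
  rw [abs_mul]
  apply mul_le_mul_of_nonneg_left _ (abs_nonneg _)
  rw [abs_mul, abs_of_pos (tB_pos a)]
  have h1 := tB_le_two a ha
  have h2 := abs_Watom_le a
  calc tB a * |Watom a| ≤ 2 * |Watom a| := mul_le_mul_of_nonneg_right h1 (abs_nonneg _)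
    _ ≤ 2 * (a * (8 + 2 * a)) := by linarith

/-- `|termBA n J a| ≤ (3J+4n+1)·4a · |coef n J (−a)|` (`a ≥ 1`). -/
theorem abs_termBA_le (n J a : ℕ) (ha : 1 ≤ a) :
    |termBA n J a| ≤ |coef n J (-(a : ℚ))| * ((3 * J + 4 * n + 1) * (4 * a)) := by
  unfold termBA
  rw [abs_mul, abs_mul, mul_assoc]
  apply mul_le_mul_of_nonneg_left _ (abs_nonneg _)
  have h1 := abs_logDer_le n J a
  have h2 : |2 * tB a * sigmaAtom a| ≤ 4 * a := by
    rw [abs_of_nonneg (by have := tB_pos a; have := sigmaAtom_nonneg a; positivity)]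
    have := tB_le_two a ha
    have := sigmaAtom_le a
    have := sigmaAtom_nonneg a
    have := tB_pos a
    nlinarith
  calc |logDer n J (-(a : ℚ))| * |2 * tB a * sigmaAtom a| ≤ (3 * J + 4 * n + 1) * |2 * tB a * sigmaAtom a| :=
        mul_le_mul_of_nonneg_right h1 (abs_nonneg _)
    _ ≤ (3 * J + 4 * n + 1) * (4 * a) := mul_le_mul_of_nonneg_left h2 (by positivity)

/-- `|termG n J a| ≤ 4a · |coef n J (−a)|` (`a ≥ 1`). -/
theorem abs_termG_le (n J a : ℕ) (ha : 1 ≤ a) : |termG n J a| ≤ |coef n J (-(a : ℚ))| * (4 * a) := by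
  unfold termG
  rw [abs_mul]
  apply mul_le_mul_of_nonneg_left _ (abs_nonneg _)
  rw [abs_of_nonneg (by have := tB_pos a; have := sigmaAtom_nonneg a; positivity)]
  have := tB_le_two a ha
  have := sigmaAtom_le a
  have := sigmaAtom_nonneg a
  have := tB_pos a
  nlinarith

/-! ### Assembly -/

/-- **Archimedean envelope of `PClosed` modulo the pole coefficients**: if `|coef n J d| ≤ E` on both index sets
(`d = c ∈ [0, J−n]` and `d = −a`, `a ∈ [1, 2n]`), then `|PClosed n J| ≤ 48 (J + 2n + 1)³ E` (`1 ≤ n ≤ J`). -/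
theorem abs_PClosed_le_of_coef (n J : ℕ) (hn : 1 ≤ n) (hJ : n ≤ J) (E : ℚ)
    (hA : ∀ c ∈ range (J - n + 1), |coef n J c| ≤ E)
    (hB : ∀ a ∈ Icc 1 (2 * n), |coef n J (-(a : ℚ))| ≤ E) :
    |PClosed n J| ≤ 48 * ((J : ℚ) + 2 * n + 1) ^ 3 * E := by
  have hE : 0 ≤ E := le_trans (abs_nonneg _) (hB 1 (Finset.mem_Icc.mpr ⟨le_refl 1, by omega⟩))
  have hJ0 : (0 : ℚ) ≤ J := by positivity
  have hn0 : (0 : ℚ) ≤ n := by positivity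
  set T : ℚ := (J : ℚ) + 2 * n + 1 with hT
  have hT1 : 1 ≤ T := by rw [hT]; linarith
  have hnT : (n : ℚ) ≤ T := by rw [hT]; linarith
  have hJT : (J : ℚ) ≤ T := by rw [hT]; linarith
  -- the three sums
  have hSA : |∑ c ∈ range (J - n + 1), termA n J c| ≤ (J - n + 1 : ℕ) * (8 * T * E) := by
    calc |∑ c ∈ range (J - n + 1), termA n J c| ≤ ∑ c ∈ range (J - n + 1), |termA n J c| :=
          Finset.abs_sum_le_sum_abs _ _
      _ ≤ ∑ c ∈ range (J - n + 1), 8 * T * E := by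
          apply Finset.sum_le_sum; intro c hc
          have hcJ : (c : ℚ) ≤ J := by
            have := Finset.mem_range.mp hc; exact_mod_cast (by omega : c ≤ J)
          calc |termA n J c| ≤ |coef n J c| * (8 * c) := abs_termA_le n J c
            _ ≤ E * (8 * T) := by
                apply mul_le_mul (hA c hc) (by linarith) (by positivity) hE
            _ = 8 * T * E := by ring
      _ = (J - n + 1 : ℕ) * (8 * T * E) := by simp
  have hSB : |∑ a ∈ Icc 1 n, (termBB n J a + termBA n J a)| ≤ n * (32 * T ^ 2 * E) := by
    calc |∑ a ∈ Icc 1 n, (termBB n J a + termBA n J a)| ≤ ∑ a ∈ Icc 1 n, |termBB n J a + termBA n J a| :=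
          Finset.abs_sum_le_sum_abs _ _
      _ ≤ ∑ a ∈ Icc 1 n, 32 * T ^ 2 * E := by
          apply Finset.sum_le_sum; intro a ha
          have ha1 : 1 ≤ a := (Finset.mem_Icc.mp ha).1
          have han : a ≤ n := (Finset.mem_Icc.mp ha).2
          have haT : (a : ℚ) ≤ T := le_trans (by exact_mod_cast han) hnT
          have ha0 : (0 : ℚ) ≤ a := by positivity
          have hB' := hB a (Finset.mem_Icc.mpr ⟨ha1, by omega⟩)
          have h1 := abs_termBB_le n J a ha1
          have h2 := abs_termBA_le n J a ha1
          have hc0 : 0 ≤ |coef n J (-(a : ℚ))| := abs_nonneg _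
          have e1 : |coef n J (-(a : ℚ))| * (2 * (a * (8 + 2 * a))) ≤ E * (20 * T ^ 2) := by
            apply mul_le_mul hB' _ (by positivity) hE
            nlinarith
          have e2 : |coef n J (-(a : ℚ))| * ((3 * J + 4 * n + 1) * (4 * a)) ≤ E * (12 * T ^ 2) := by
            apply mul_le_mul hB' _ (by positivity) hE
            have : (3 * (J : ℚ) + 4 * n + 1) ≤ 3 * T := by rw [hT]; linarith
            nlinarith
          calc |termBB n J a + termBA n J a| ≤ |termBB n J a| + |termBA n J a| := abs_add_le _ _
            _ ≤ E * (20 * T ^ 2) + E * (12 * T ^ 2) := by linarith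
            _ = 32 * T ^ 2 * E := by ring
      _ = n * (32 * T ^ 2 * E) := by simp
  have hSG : |∑ a ∈ Icc (n + 1) (2 * n), termG n J a| ≤ n * (4 * T * E) := by
    calc |∑ a ∈ Icc (n + 1) (2 * n), termG n J a| ≤ ∑ a ∈ Icc (n + 1) (2 * n), |termG n J a| :=
          Finset.abs_sum_le_sum_abs _ _
      _ ≤ ∑ a ∈ Icc (n + 1) (2 * n), 4 * T * E := by
          apply Finset.sum_le_sum; intro a ha
          have ha1 : n + 1 ≤ a := (Finset.mem_Icc.mp ha).1
          have han : a ≤ 2 * n := (Finset.mem_Icc.mp ha).2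
          have ha2 : (a : ℚ) ≤ 2 * n := by exact_mod_cast han
          have haT : (a : ℚ) ≤ T := by rw [hT]; linarith
          have hB' := hB a (Finset.mem_Icc.mpr ⟨by omega, han⟩)
          calc |termG n J a| ≤ |coef n J (-(a : ℚ))| * (4 * a) := abs_termG_le n J a (by omega)
            _ ≤ E * (4 * T) := by
                apply mul_le_mul hB' (by linarith) (by positivity) hE
            _ = 4 * T * E := by ring
      _ = n * (4 * T * E) := by
          have hc : (Icc (n + 1) (2 * n)).card = n := by simp; omega
          rw [Finset.sum_const, hc, nsmul_eq_mul]
  have hcard : ((J - n + 1 : ℕ) : ℚ) ≤ T := by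
    rw [hT]; push_cast [Nat.cast_sub hJ]; linarith
  unfold PClosed
  calc |(∑ c ∈ range (J - n + 1), termA n J c) + (∑ a ∈ Icc 1 n, (termBB n J a + termBA n J a))
        + ∑ a ∈ Icc (n + 1) (2 * n), termG n J a|
      ≤ |(∑ c ∈ range (J - n + 1), termA n J c) + (∑ a ∈ Icc 1 n, (termBB n J a + termBA n J a))|
        + |∑ a ∈ Icc (n + 1) (2 * n), termG n J a| := abs_add_le _ _
    _ ≤ (|∑ c ∈ range (J - n + 1), termA n J c| + |∑ a ∈ Icc 1 n, (termBB n J a + termBA n J a)|)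
        + |∑ a ∈ Icc (n + 1) (2 * n), termG n J a| := by gcongr; exact abs_add_le _ _
    _ ≤ (J - n + 1 : ℕ) * (8 * T * E) + n * (32 * T ^ 2 * E) + n * (4 * T * E) := by linarith
    _ ≤ T * (8 * T * E) + T * (32 * T ^ 2 * E) + T * (4 * T * E) := by
        have h8 : 0 ≤ 8 * T * E := by positivity
        have h32 : 0 ≤ 32 * T ^ 2 * E := by positivity
        have h4 : 0 ≤ 4 * T * E := by positivity
        have := mul_le_mul_of_nonneg_right hcard h8
        have := mul_le_mul_of_nonneg_right hnT h32
        have := mul_le_mul_of_nonneg_right hnT h4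
        linarith
    _ ≤ 48 * T ^ 3 * E := by
        have hT0 : 0 ≤ T := le_trans zero_le_one hT1
        have hT2E : 0 ≤ T ^ 2 * E := by positivity
        have hTT : T ^ 2 ≤ T ^ 3 := by nlinarith
        nlinarith [mul_le_mul_of_nonneg_right hTT hE]

end Summit.KontsevichZagierPeriods.Zeta5Search.Denom.CatalanRayPClosed
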